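import Summits.ResolutionOfSingularities.ResolutionOfSingularities.Theorems.MarkedTransferCampaignW13BypassCriteria
import Mathlib.RingTheory.IntegralClosure.IsIntegralClosure.Basic
import HarnessLib

/-!
# [OURS · L1 W1.3] F7′ consumer table, rows 2(a) and 4, kernel form: the R-flat cotangent module vanishes on `Sing(Ě)`
# (what Th 15.9's proof draws from the slot), and the bound `℘̃_flat` is integrally closed (what Th 7.11 (2) supplies)
# (seat res-L1-s13-pv-1)

LADDER-RESOLUTION rung L (rescue), cell `res-hironaka`, RESCUE-SEED slot W1.3 (reading R-flat). Director-resolution 2026-08-27T01:05:24Z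
(1): W1.3's next rung = the F7′ CONSUMER TABLE — for each consumer of the §13 tails slot ((110) `Eq110`, Th 15.9's chain `Thm15_9*`,
Rem 5.4 `Rem5_4`, Th 7.11 (2)) the statement it needs from `Cot_flat` as an OURS signature, or «cannot be re-fed». This seat's draft
table is HOME/L/res-L1-s13-pv-1/F7PRIME-TABLE-W13.md (standing in for the unseated res-L1-s13-plan-1); row 1 is CLOSED on `𝒞_Diff`
by p482051 (`Campaign.CampaignW13RFlatTailPowDiffKnockOut_holds`) and refuted on the recipe-∀ class by p481686; this file lands
the two rows marked «feedable now»: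

* ROW 2(a) — what Th 15.9's proof (p.79 L16–L19: «𝔏♯(Ě)(ξ) = 0 and hence 𝔏♭(Ě)(ξ) = 0 and hence Cot(Ě)(ξ) = 0») draws from the
  slot: the cotangent module VANISHES on `Sing(Ě)`. Under the printed collapse this FAILS (`Cot = 𝒪`, res-adj-1 R08α,
  `S13GLUEDDiagram.Cot_eq_top_of_degree_full`). Under R-flat it HOLDS from the §13.1 clause alone: `𝔏_0(∞) ⊂ I(Sing)Bl(Z)`
  (row 015 `U67_2`, p.67 L15, taken as a HYPOTHESIS) gives `Cot_flat ⊆ √I(Sing)` (`bypassCotRFlat_le_radical_of_U67_2`), hence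
  `Cot_flat ⊆ I(Sing)` for radical `I(Sing)`; the `℘(Ě,1)`-factor of the R-flat module is not even needed.
* ROW 4 — what Th 7.11 (2) p.38 L30 («`℘̃(E)` is integrally closed in `Bl(Z)`») supplies: for the bound `℘̃_flat` (degrees `≥ 0`
  = row 003's `pAlgebraicRing K O J b`, the integral closure of the Diff-subalgebra in `O[X]`) integral closedness in `O[X]` holds
  BY CONSTRUCTION (`pAlgebraicRing_mem_of_isIntegral`, `pAlgPiece_mem_of_isIntegral`); the negative half of Th 7.11 (2) has no
  object under the bypass (vacated; its printed use Th 7.12 / GAP R34 is then moot).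

HONEST FRAMING. Nothing here is a statement of H. Hironaka's manuscript [Hironaka2017]; Th 15.9 p.79, Th 7.11 p.38, §13.1 p.67 are
CANDIDATES [claim: Hironaka2017, status: under-review] entering only as typed carriers / hypotheses. OURS bookkeeping about OUR
reading; RESCUE-SEED's caveat stands (any R-flat finding leaves L-G4 / (127) open; `KangarooShadeIncrease.Hauser2003_kangarooShadeIncrease`).
AI computation is weaker than expert review; nothing here is progress on resolution of singularities in positive characteristic.
Helper filed `--supports stmt-ResolutionOfSingularities-15522`; PROOFS ONLY, no new objects.

CONTENTS (all `[folklore]`, sorry-free): `fnorm_le_ideal_of_U67_2`, `bypassTFlatRFlat_le_ideal_of_U67_2`,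
`bypassCotRFlat_le_radical_of_U67_2`, `bypassCotRFlat_le_of_U67_2_of_isRadical`, `bypassCotRFlatAlg_le_radical_of_U67_2` (row 2(a));
`pAlgebraicRing_mem_of_isIntegral`, `pAlgPiece_mem_of_isIntegral` (row 4).
-/

noncomputable section

set_option linter.dupNamespace false -- mandated namespace of this single-conjunct summit

namespace Summit.ResolutionOfSingularities.ResolutionOfSingularities.Theorems.Campaign.W13

open LaurentPolynomial
open Literature.AlgebraicGeometry.Hironaka2017
open Literature.AlgebraicGeometry.Hironaka2017.S11CoordFree (BlSub)
open Literature.AlgebraicGeometry.Hironaka2017.S12GLUED (forgetDeg fnorm)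
open Literature.AlgebraicGeometry.Hironaka2017.S13GLUEDDiagram (U67_2 forgetDeg_mem_ideal_of_mem_span)

universe u v

/-! ## Row 2(a): `Cot_flat` vanishes on `Sing(Ě)` (from the §13.1 clause `U67_2` alone) -/

section RowTwo

variable {O : Type v} [CommRing O] {p : ℕ} [Fact p.Prime] [CharP O p] {ℓ : ℕ}

/-- `𝔏_0(∞) ⊂ I(Sing)·Bl(Z)` (row 015 `U67_2`, p.67 L15, hypothesis) ⇒ `∥𝔏_0(∞)∥ ⊆ I(Sing)`. [folklore] -/
theorem fnorm_le_ideal_of_U67_2 {tau0 : BlSub O p ℓ → BlSub O p ℓ} {L0inf : BlSub O p ℓ} {ISing : Ideal O}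
    (hU : U67_2 tau0 L0inf ISing) :
    fnorm (iterateFrobenius O p ℓ).range L0inf ≤ ISing.restrictScalars _ := by
  rintro b ⟨x, hx, rfl⟩
  exact forgetDeg_mem_ideal_of_mem_span ISing (hU.2 hx)

/-- Hence the R-flat module `∥𝔏_0(∞)∥ ∩ P1 ⊆ I(Sing)` (for every `P1`). [folklore] -/
theorem bypassTFlatRFlat_le_ideal_of_U67_2 {tau0 : BlSub O p ℓ → BlSub O p ℓ} {L0inf : BlSub O p ℓ} {ISing : Ideal O}
    (hU : U67_2 tau0 L0inf ISing) (P1 : Ideal O) :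
    Campaign.bypassTFlatRFlat L0inf P1 ≤ ISing.restrictScalars _ :=
  (Campaign.bypassTFlatRFlat_le L0inf P1).trans (fnorm_le_ideal_of_U67_2 hU)

/-- **F7′ row 2(a).** Under the §13.1 clause `U67_2` (hypothesis), the R-flat cotangent module lies in `√I(Sing(Ě))`: every
`φ ∈ Cot_flat` has `φ^{p^e} ∈ ∥𝔏_0(∞)∥ ⊆ I(Sing)`. This is the input «`Cot(Ě)(ξ) = 0` at `ξ ∈ Sing(Ě)`» of Th 15.9's proof
(p.79 L16–L19), re-fed from `Cot_flat`. [folklore] -/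
theorem bypassCotRFlat_le_radical_of_U67_2 {tau0 : BlSub O p ℓ → BlSub O p ℓ} {L0inf : BlSub O p ℓ} {ISing : Ideal O}
    (hU : U67_2 tau0 L0inf ISing) (e : ℕ) (P1 : Ideal O) {φ : O} (hφ : φ ∈ Campaign.bypassCotRFlat e L0inf P1) :
    φ ∈ ISing.radical :=
  ⟨p ^ e, fnorm_le_ideal_of_U67_2 hU ((mem_bypassCotRFlat_iff e L0inf P1 φ).mp hφ).1⟩

/-- … hence `Cot_flat ⊆ I(Sing)` itself when `I(Sing)` is radical (the ideal of the reduced closed set `Sing(Ě)`). [folklore] -/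
theorem bypassCotRFlat_le_of_U67_2_of_isRadical {tau0 : BlSub O p ℓ → BlSub O p ℓ} {L0inf : BlSub O p ℓ} {ISing : Ideal O}
    (hU : U67_2 tau0 L0inf ISing) (hrad : ISing.IsRadical) (e : ℕ) (P1 : Ideal O) {φ : O}
    (hφ : φ ∈ Campaign.bypassCotRFlat e L0inf P1) : φ ∈ ISing :=
  hrad (bypassCotRFlat_le_radical_of_U67_2 hU e P1 hφ)

end RowTwo

section RowTwoBound

open Literature.AlgebraicGeometry.Hironaka2017.S04CharAlgebra

variable (K : Type u) [CommRing K] {O : Type u} [CommRing O] [Algebra K O] {p : ℕ} [Fact p.Prime] [CharP O p] {ℓ : ℕ}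

/-- Row 2(a) for the BOUND module `bypassCotRFlatAlg` (`P1 := ℘(Ě,1)` algebraic, v3). [folklore] -/
theorem bypassCotRFlatAlg_le_radical_of_U67_2 {tau0 : BlSub O p ℓ → BlSub O p ℓ} {L0inf : BlSub O p ℓ} {ISing : Ideal O}
    (hU : U67_2 tau0 L0inf ISing) (e : ℕ) (J : Ideal O) (b : ℕ) {φ : O}
    (hφ : φ ∈ Campaign.bypassCotRFlatAlg K e J b L0inf) : φ ∈ ISing.radical :=
  bypassCotRFlat_le_radical_of_U67_2 hU e _ hφ

end RowTwoBound

/-! ## Row 4: the bound `℘̃_flat` (degrees `≥ 0`) is integrally closed in `O[X]` by construction -/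

section RowFour

open Polynomial
open Literature.AlgebraicGeometry.Hironaka2017.S04CharAlgebra

variable (K : Type u) [CommRing K] {O : Type u} [CommRing O] [Algebra K O]

/-- **F7′ row 4.** Row 003's `pAlgebraicRing K O J b` — the integral closure in `O[X]` of the Diff-subalgebra of `Ě = (J,b)`, i.e.
the bound `℘(Ě) = ⊕_{a ≥ 0} ℘(Ě,a)X^a` — is integrally closed in `O[X]`: an element of `O[X]` integral over it already lies in it
(integral over the integral closure ⇒ integral over the Diff-subalgebra, Mathlib `isIntegral_trans`). This is Th 7.11 (2)'s
content for the non-negative degrees, re-fed by construction; the negative degrees are vacated under the bypass. [folklore] -/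
theorem pAlgebraicRing_mem_of_isIntegral (J : Ideal O) (b : ℕ) {x : O[X]}
    (hx : IsIntegral (integralClosure (diffSubalgebra K O J b) O[X]) x) : x ∈ pAlgebraicRing K O J b := by
  rw [pAlgebraicRing, Subalgebra.mem_restrictScalars, mem_integralClosure_iff]
  exact isIntegral_trans (R := ↥(diffSubalgebra K O J b)) (A := ↥(integralClosure (diffSubalgebra K O J b) O[X])) x hx

/-- Degree-wise form: if `c·X^a` is integral over the bound `℘(Ě)` then `c ∈ ℘(Ě,a)` (`Campaign.pAlgPiece`, v3). [folklore] -/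
theorem pAlgPiece_mem_of_isIntegral (J : Ideal O) (b a : ℕ) {c : O}
    (hc : IsIntegral (integralClosure (diffSubalgebra K O J b) O[X]) (monomial a c)) :
    c ∈ Campaign.pAlgPiece K J b a :=
  (mem_pAlgPiece_iff K J b a c).mpr (pAlgebraicRing_mem_of_isIntegral K J b hc)

end RowFour

end Summit.ResolutionOfSingularities.ResolutionOfSingularities.Theorems.Campaign.W13

end
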